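import Mathlib
import Literature.NumberTheory.Automorphic.UnboundedDenominators
import Literature.NumberTheory.Automorphic.UnboundedDenominatorsGammaInvariance
import Literature.NumberTheory.Automorphic.UnboundedDenominatorsReductions

/-!
# Stub `stub_congruenceEndgame` for line `Sketch` (crux stmt-Langlands-8457)

Route `CapacityClassicality`, crux
`Summit.Langlands.Langlands.Theses.CapacityClassicality.IntegralOverconvergentIsCongruence`.

**Congruence endgame.** Assuming the unbounded denominators theorem of Calegari–Dimitrov–Tang in
its algebraic-integer form (the tree's named fact
`Literature.NumberTheory.Automorphic.CalegariDimitrovTang2025_unboundedDenominators_algInt`, taken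
here as the hypothesis `hCDT`), a modular form `f` of weight `k` on a finite-index subgroup
`Γ ∋ T` of `SL(2, ℤ)` whose `q`-expansion at `∞` (period `1`) is `(Σ σ₀(aₙ) qⁿ) · Δ(q)ᵐ` with `aₙ`
algebraic integers of a field `E` is the function of a modular form of weight `k` on `Γ₁(M)` for
some `M ≥ 1`:

1. the coefficients of `qExpansion 1 f` are algebraic integers (Cauchy product of the `σ₀(aₙ)` with
   the rational-integer coefficients of `Δᵐ`, `exists_discriminant_qExpansion_eq_map`);
2. `1` is a strict period of `Γ` (`T ∈ Γ`), so `hCDT` yields a congruence subgroup `Γ' ⊇ Γ(M)`,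
   `M ≠ 0`, and a modular form `g` on `Γ'` with `⇑g = ⇑f`;
3. `Γ₁(M) = ⟨T⟩ · Γ(M)` (`exists_eq_T_zpow_mul_of_mem_Gamma1`): `f` is invariant under `T ∈ Γ` and
   under `Γ(M) ≤ Γ'`, hence under `Γ₁(M)`; bundling `f` on `Γ₁(M)` (holomorphy is that of `f`,
   the cusps of `Γ₁(M)` are those of `Γ`, both groups being arithmetic) finishes.
-/

set_option linter.dupNamespace false -- project-wide option (lakefile weak.linter.dupNamespace); `Summit.Langlands.Langlands` is the mandated namespace

open scoped MatrixGroups Manifold Topology ModularForm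
open UpperHalfPlane CongruenceSubgroup Metric PowerSeries
open Literature.NumberTheory.Automorphic

noncomputable section

namespace Summit.Langlands.Langlands.Theorems.CapacityClassicality

/-- Entries of `Tᵉ γ` for `γ ∈ SL(2, ℤ)`: `Tᵉ [a b; c d] = [a + e c, b + e d; c, d]`. [folklore] -/
theorem T_zpow_mul_entries (e : ℤ) (γ : SL(2, ℤ)) :
    (ModularGroup.T ^ e * γ) 0 0 = γ 0 0 + e * γ 1 0 ∧
      (ModularGroup.T ^ e * γ) 0 1 = γ 0 1 + e * γ 1 1 ∧
      (ModularGroup.T ^ e * γ) 1 0 = γ 1 0 ∧ (ModularGroup.T ^ e * γ) 1 1 = γ 1 1 := by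
  -- adapted from `Literature.NumberTheory.Automorphic.UnboundedDenominatorsReductions`
  simp [Matrix.SpecialLinearGroup.coe_mul, ModularGroup.coe_T_zpow, Matrix.mul_apply,
    Fin.sum_univ_two]

/-- **`Γ₁(N) = ⟨T⟩ · Γ(N)`.** Every `γ ∈ Γ₁(N)` factors as `γ = Tᵇ γ₀` with `γ₀ ∈ Γ(N)`: take
`b = γ 0 1` and `γ₀ = T⁻ᵇ γ`, whose entries are `≡ [1 0; 0 1] (mod N)` since
`γ ≡ [1 b; 0 1] (mod N)`. [folklore] -/
theorem exists_eq_T_zpow_mul_of_mem_Gamma1 {N : ℕ} {γ : SL(2, ℤ)}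
    (hγ : γ ∈ CongruenceSubgroup.Gamma1 N) :
    ∃ (b : ℤ) (γ₀ : SL(2, ℤ)), γ₀ ∈ CongruenceSubgroup.Gamma N ∧ γ = ModularGroup.T ^ b * γ₀ := by
  obtain ⟨h00, h11, h10⟩ := (Gamma1_mem N γ).mp hγ
  refine ⟨γ 0 1, ModularGroup.T ^ (-(γ 0 1)) * γ, ?_, by rw [zpow_neg, mul_inv_cancel_left]⟩
  obtain ⟨e00, e01, e10, e11⟩ := T_zpow_mul_entries (-(γ 0 1)) γ
  rw [Gamma_mem, e00, e01, e10, e11]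
  refine ⟨?_, ?_, h10, h11⟩
  · push_cast
    rw [h00, h10]
    ring
  · push_cast
    rw [h11]
    ring

/-- **Invariance under `Γ₁(M)` from invariance under `⟨T⟩` and `Γ(M)`.** If a function `f` on
`ℍ` is weight-`k` invariant under every power `Tᵇ` and under every element of `Γ(M)`, it is
weight-`k` invariant under every element of `Γ₁(M) = ⟨T⟩ · Γ(M)`. [folklore] -/
theorem slash_eq_of_mem_Gamma1 {k : ℤ} {f : ℍ → ℂ} {M : ℕ}
    (hT : ∀ b : ℤ,
      f ∣[k] (Matrix.SpecialLinearGroup.mapGL ℝ (ModularGroup.T ^ b) : GL (Fin 2) ℝ) = f)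
    (hΓ : ∀ γ ∈ CongruenceSubgroup.Gamma M,
      f ∣[k] (Matrix.SpecialLinearGroup.mapGL ℝ γ : GL (Fin 2) ℝ) = f)
    {γ : SL(2, ℤ)} (hγ : γ ∈ CongruenceSubgroup.Gamma1 M) :
    f ∣[k] (Matrix.SpecialLinearGroup.mapGL ℝ γ : GL (Fin 2) ℝ) = f := by
  obtain ⟨b, γ₀, hγ₀, rfl⟩ := exists_eq_T_zpow_mul_of_mem_Gamma1 hγ
  rw [map_mul, SlashAction.slash_mul, hT b, hΓ γ₀ hγ₀]

/-- **Registered stub `stub_congruenceEndgame`** (line `Sketch`, crux stmt-Langlands-8457).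
**Congruence endgame.** Assuming Calegari–Dimitrov–Tang's unbounded denominators theorem
(algebraic-integer form, hypothesis `hCDT`), a modular form `f` of weight `k` on a finite-index
`Γ ∋ T` whose `q`-expansion is `(Σ σ₀(aₙ)qⁿ) · Δᵐ` with `aₙ` algebraic integers is (the function
of) a modular form of the same weight on `Γ₁(M)` for some `M ≥ 1`: CDT gives a congruence level
`Γ' ⊇ Γ(M)` carrying `f`, and `f ∣ T = f` upgrades `Γ(M)` to `⟨Γ(M), T⟩ = Γ₁(M)`.
[cite: CalegariDimitrovTang2025, Remark 58 and Remark 59] -/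
theorem stub_congruenceEndgame (hCDT : CalegariDimitrovTang2025_unboundedDenominators_algInt)
    {E : Type} [Field E] (σ₀ : E →+* ℂ) (a : ℕ → E) (hint : ∀ n, IsIntegral ℤ (a n))
    (Γ : Subgroup SL(2, ℤ)) [Γ.FiniteIndex] (hT : ModularGroup.T ∈ Γ) (k : ℤ) (m : ℕ)
    (f : ModularForm (Γ : Subgroup (GL (Fin 2) ℝ)) k)
    (hqf : qExpansion 1 ⇑f =
      PowerSeries.mk (fun n ↦ σ₀ (a n)) * (qExpansion 1 ⇑CuspForm.discriminant) ^ m) :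
    ∃ (M : ℕ) (_ : NeZero M) (F : ModularForm (CongruenceSubgroup.Gamma1 M) k),
      qExpansion 1 ⇑F = qExpansion 1 ⇑f := by
  -- (1) the coefficients of `qExpansion 1 f` are algebraic integers
  have hint' : ∀ n : ℕ, IsIntegral ℤ (PowerSeries.coeff n (qExpansion ((1 : ℕ) : ℝ) ⇑f)) := by
    intro n
    obtain ⟨D, hD⟩ := exists_discriminant_qExpansion_eq_map
    rw [Nat.cast_one, hqf, CuspForm.coe_discriminant, hD, ← map_pow, PowerSeries.coeff_mul]
    refine IsIntegral.sum _ fun p _ ↦ ?_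
    rw [PowerSeries.coeff_mk, PowerSeries.coeff_map, ← algebraMap_int_eq]
    exact (map_isIntegral_int σ₀ (hint p.1)).mul isIntegral_algebraMap
  -- (2) `1` is a strict period of `Γ`, since `T ∈ Γ`
  have h1 : ((1 : ℕ) : ℝ) ∈ (Γ : Subgroup (GL (Fin 2) ℝ)).strictPeriods :=
    mem_strictPeriods_of_T_pow_mem (by rwa [pow_one])
  -- (3) Calegari–Dimitrov–Tang: `f` is a modular form on a congruence subgroup `Γ' ⊇ Γ(M)`
  obtain ⟨Γ', g, ⟨M, hM0, hle⟩, hgf⟩ := hCDT Γ k f 1 one_pos h1 hint'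
  haveI : NeZero M := ⟨hM0⟩
  -- (4) invariance of `f` under `Γ₁(M) = ⟨T⟩ · Γ(M)`
  have hfT : ∀ b : ℤ, (⇑f : ℍ → ℂ) ∣[k]
      (Matrix.SpecialLinearGroup.mapGL ℝ (ModularGroup.T ^ b) : GL (Fin 2) ℝ) = ⇑f := fun b ↦
    SlashInvariantForm.slash_action_eqn f _ (Subgroup.mem_map_of_mem _ (Subgroup.zpow_mem Γ hT b))
  have hfΓ : ∀ γ ∈ CongruenceSubgroup.Gamma M,
      (⇑f : ℍ → ℂ) ∣[k] (Matrix.SpecialLinearGroup.mapGL ℝ γ : GL (Fin 2) ℝ) = ⇑f := by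
    intro γ hγ
    have hmem : (Matrix.SpecialLinearGroup.mapGL ℝ γ : GL (Fin 2) ℝ) ∈
        (Γ' : Subgroup (GL (Fin 2) ℝ)) :=
      Subgroup.mem_map_of_mem _ (hle hγ)
    simpa only [hgf] using SlashInvariantForm.slash_action_eqn g _ hmem
  -- (5) bundle `f` as a modular form on `Γ₁(M)`: holomorphy is that of `f`, and the cusps of
  -- `Γ₁(M)` are those of `Γ` (both arithmetic: `isCusp_iff_isCusp_SL2Z`)
  let F : ModularForm (CongruenceSubgroup.Gamma1 M : Subgroup (GL (Fin 2) ℝ)) k :=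
    { toFun := f
      slash_action_eq' := by
        rintro _ ⟨γ, hγ, rfl⟩
        exact slash_eq_of_mem_Gamma1 hfT hfΓ hγ
      holo' := f.holo'
      bdd_at_cusps' := fun hc ↦ f.bdd_at_cusps'
        ((Subgroup.IsArithmetic.isCusp_iff_isCusp_SL2Z _).mpr
          ((Subgroup.IsArithmetic.isCusp_iff_isCusp_SL2Z _).mp hc)) }
  exact ⟨M, ⟨hM0⟩, F, rfl⟩

end Summit.Langlands.Langlands.Theorems.CapacityClassicality

end
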